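import Summits.ResolutionOfSingularities.ResolutionOfSingularities.Theorems.PurelyInseparableDim4ResConeShearTransport
import Summits.ResolutionOfSingularities.ResolutionOfSingularities.Theorems.PurelyInseparableDim4Mode0UmbrellaSteps
import HarnessLib

/-!
# Purely inseparable four-folds — L-LIGHT KILL, part F1: MAXIMAL CONTACT BY THE FREE LETTER FORCES THE TRANSLATIONS TO DIE
# (cell `res-dim4-pi`, K2(p) lane, the open loss-free `e = 3` cell; seat res-dim4-p-9 g6; HOME-only under desk R-251)

[OURS · counted 0]  Nothing here proves any TAIL(p, d, 3), K2(7), K2(p) or resolution of singularities in dimension ≥ 4 /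
characteristic `p` — NOT proved.  Pure coefficient algebra of OUR frame's point step.  AI kernel work, weaker than expert review.

THE WEIGHT-ONE CHAIN.  Letters: two chart letters `A ≠ B` and a free letter `φ` (the only translated one).  A base exponent `r₀`
with `r₀ φ = 0`, `r₀ A = r₀ B`, and the chart exponent `Q` with `Q + r₀ A = |r₀| + 1` (so that RELATIVE to `r₀` the chart law is
the weight-ONE law `d ↦ d[j ↦ |d| − 1]`).  A sequence `w k` of polynomials with every monomial `> r₀` (componentwise `≥ r₀`, `≠ r₀`:
«`w_k(0) = 0` relative to `r₀`») obeying `w (k+1) = chartTransform Q univ (j k) (shear (j k) (β_k • e_φ) (w k))`, `j k ∈ {A, B}`, both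
letters charted beyond every time, and `coeff (r₀ + e_φ) (w m) ≠ 0` («`∂_φ w ≠ 0`: the hypersurface `W = {w = 0}` is a graph over
`(A, B)`»).  THEN `β_k = 0` for all large `k` (`weightOne_translations_eventually_zero`).

MECHANISM (memo `res-dim4-p-9/memo/L-LIGHT-KILL-g6.md` §5): `λ_φ := coeff (r₀ + e_φ)` is invariant; INCIDENCE `coeff r₀ (w (k+1)) =
λ_{j k} + β_k λ_φ = 0` forces `β_k = −λ_{j k}/λ_φ`; after a `B`-step the `(A, φ)`-plane of `w` is the linear form `λ_A x_A + λ_φ x_φ`, so the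
following `A`-step puts the whole `A`-axis on `W` (`coeff (r₀ + n e_A) = 0 ∀ n`), a property that PERSISTS under both step types and
forces `β = 0` at every later `A`-step; symmetrically for `B` after the next `A → B` transition.  In the L-light kill this is applied to
`w k := D_φ^{(e−1)}` of the stationary witness slice (tree law `ResCone.chain_hasseDeriv_single_step_F`).
[cite: Hauser2010, §§F–G, §I (P⁺)] [cite: HauserPerlega2019PRIMS, §2 (transform at a translated point)]
[cite: CossartJannsenSaito2020, Lemma 13.2 (maximal contact in the tangent cone)]
bears_on: LADDER-RESOLUTION:D157-DOOR2 (res-dim4-pi · K2(p) L-light cell · weight-one finiteness).  Supports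
stmt-ResolutionOfSingularities-16155 (helper).
-/

set_option linter.dupNamespace false -- mandated namespace of this single-conjunct summit

noncomputable section

namespace Summit.ResolutionOfSingularities.ResolutionOfSingularities.Theorems.PIDim4

namespace ResCone

namespace LLight

open MvPolynomial Finset
open Literature.AlgebraicGeometry.Resolution
open Literature.AlgebraicGeometry.Resolution.CentreBlowup
open Literature.AlgebraicGeometry.Resolution.Hauser2010

variable {K : Type} [Field K]

/-! ## 1. Tools: coefficients of the uncleaned chart transform -/

/-- The chart law is injective on exponents of degree `≥ Q`: the coefficient of a chart image. [folklore] -/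
theorem coeff_chartTransform_chartExponent_of_le {Q : ℕ} {j : Fin 4} {P : MvPolynomial (Fin 4) K}
    (hP : ∀ d ∈ P.support, Q ≤ d.degree) {e : Fin 4 →₀ ℕ} (he : Q ≤ e.degree) :
    coeff (chartExponent Q Finset.univ j e) (chartTransform Q Finset.univ j P) = coeff e P := by
  classical
  by_cases hes : e ∈ P.support
  · exact Mode0Umbrella.coeff_chartTransform_univ hP hes
  · rw [MvPolynomial.notMem_support_iff.mp hes]
    by_contra hne
    obtain ⟨d, hd, hde⟩ := Mode0Umbrella.exists_of_mem_support_chartTransform (MvPolynomial.mem_support_iff.mpr hne)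
    exact hes (Mode0Umbrella.chartExponent_univ_inj (hP d hd) he hde ▸ hd)

/-- A target exponent that is no chart image of a monomial has coefficient `0`. [folklore] -/
theorem coeff_chartTransform_eq_zero_of_forall {Q : ℕ} {j : Fin 4} {P : MvPolynomial (Fin 4) K} {E : Fin 4 →₀ ℕ}
    (h : ∀ d ∈ P.support, chartExponent Q Finset.univ j d ≠ E) :
    coeff E (chartTransform Q Finset.univ j P) = 0 := by
  classical
  by_contra hne
  obtain ⟨d, hd, hde⟩ := Mode0Umbrella.exists_of_mem_support_chartTransform (MvPolynomial.mem_support_iff.mpr hne)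
  exact h d hd hde

/-! ## 2. Polynomials living strictly above a base exponent `r₀` (every monomial `E` has `r₀ ≤ E`, `E ≠ r₀`) -/

/-- `r₀ ≤ E` gives `|r₀| ≤ |E|`, with equality only for `E = r₀`. [folklore] -/
theorem degree_lt_of_le_of_ne {r₀ E : Fin 4 →₀ ℕ} (hle : r₀ ≤ E) (hne : E ≠ r₀) : r₀.degree < E.degree := by
  have h0 := hle 0; have h1 := hle 1; have h2 := hle 2; have h3 := hle 3
  rw [Finsupp.degree_eq_sum, Finsupp.degree_eq_sum, Fin.sum_univ_four, Fin.sum_univ_four]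
  by_contra hge
  push Not at hge
  apply hne
  ext i
  fin_cases i <;> simp only [Fin.zero_eta, Fin.mk_one, Fin.reduceFinMk] <;> omega

/-- A coefficient below `r₀` in one letter vanishes. [folklore] -/
theorem coeff_eq_zero_of_lt_base {r₀ : Fin 4 →₀ ℕ} {G : MvPolynomial (Fin 4) K} (hG : ∀ E ∈ G.support, r₀ ≤ E ∧ E ≠ r₀)
    {E : Fin 4 →₀ ℕ} {i : Fin 4} (h : E i < r₀ i) : coeff E G = 0 := by
  by_contra hne
  have := (hG E (MvPolynomial.mem_support_iff.mpr hne)).1 i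
  omega

/-- The base coefficient vanishes. [folklore] -/
theorem coeff_base_eq_zero {r₀ : Fin 4 →₀ ℕ} {G : MvPolynomial (Fin 4) K} (hG : ∀ E ∈ G.support, r₀ ≤ E ∧ E ≠ r₀) :
    coeff r₀ G = 0 := by
  by_contra hne
  exact (hG r₀ (MvPolynomial.mem_support_iff.mpr hne)).2 rfl

/-- Degrees above `r₀`. [folklore] -/
theorem degree_lt_of_mem_support_above {r₀ : Fin 4 →₀ ℕ} {G : MvPolynomial (Fin 4) K}
    (hG : ∀ E ∈ G.support, r₀ ≤ E ∧ E ≠ r₀) {E : Fin 4 →₀ ℕ} (hE : E ∈ G.support) : r₀.degree < E.degree :=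
  degree_lt_of_le_of_ne (hG E hE).1 (hG E hE).2

/-- **The shear `x_φ ↦ x_φ + t x_j` keeps a polynomial strictly above `r₀`** when `r₀ φ = 0`. [folklore]
[cite: Hauser2010, §I (P⁺)] -/
theorem above_shear {r₀ : Fin 4 →₀ ℕ} {G : MvPolynomial (Fin 4) K} (hG : ∀ E ∈ G.support, r₀ ≤ E ∧ E ≠ r₀) {j φ : Fin 4}
    (hjφ : j ≠ φ) (hr₀ : r₀ φ = 0) (t : K) : ∀ E ∈ (shear j (Pi.single φ t) G).support, r₀ ≤ E ∧ E ≠ r₀ := by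
  intro E hE
  obtain ⟨m, hm, l, hl, rfl⟩ := exists_of_mem_support_shear_single hjφ t G hE
  obtain ⟨hle, hne⟩ := hG m hm
  refine ⟨fun i => ?_, fun h => ?_⟩
  · rw [shear_target_apply hjφ]
    split_ifs with h1 h2
    · subst h1; exact (hle i).trans (Nat.le_add_right _ _)
    · subst h2; rw [hr₀]; exact Nat.zero_le _
    · exact hle i
  · apply hne
    have hj : ((m.update φ (m φ - l)).update j (m j + l)) j = r₀ j := by rw [h]
    rw [Finsupp.coe_update, Function.update_self] at hj
    have hl0 : l = 0 := by have := hle j; omega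
    subst hl0
    rw [← h]
    ext i
    rw [shear_target_apply hjφ]
    split_ifs with h1 h2
    · subst h1; rfl
    · subst h2; exact Nat.sub_zero _
    · rfl

/-! ## 3. The weight-one step relative to `r₀`: four coefficient identities -/

section Step

variable {r₀ : Fin 4 →₀ ℕ} {Q : ℕ} {j φ : Fin 4} {G : MvPolynomial (Fin 4) K} {t : K}

/-- `Q ≤` the degree of every monomial of the sheared polynomial. -/
theorem le_degree_shear (hG : ∀ E ∈ G.support, r₀ ≤ E ∧ E ≠ r₀) (hjφ : j ≠ φ) (hr₀ : r₀ φ = 0) (hQ : Q + r₀ j = r₀.degree + 1) :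
    ∀ d ∈ (Hauser2010.shear j (Pi.single φ t) G).support, Q ≤ d.degree := fun d hd => by
  have := degree_lt_of_mem_support_above (above_shear hG hjφ hr₀ t) hd; omega

/-- The chart law relative to `r₀` lowers the `j`-exponent by one: `chartExponent Q (r₀ + (n+1) e_j) = r₀ + n e_j`. [folklore] -/
theorem chartExponent_base_add_single (hQ : Q + r₀ j = r₀.degree + 1) (n : ℕ) :
    chartExponent Q Finset.univ j (r₀ + Finsupp.single j (n + 1)) = r₀ + Finsupp.single j n := by
  rw [chartExponent_eq_iff]
  refine ⟨?_, fun i hi => ?_⟩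
  · rw [degIn_univ, map_add, Finsupp.degree_single, Finsupp.add_apply, Finsupp.single_eq_same]; omega
  · rw [Finsupp.add_apply, Finsupp.add_apply, Finsupp.single_eq_of_ne hi, Finsupp.single_eq_of_ne hi]

/-- The chart law relative to `r₀` fixes `r₀ + e_i` for `i ≠ j`. [folklore] -/
theorem chartExponent_base_add_single_of_ne (hQ : Q + r₀ j = r₀.degree + 1) {i : Fin 4} (hij : i ≠ j) :
    chartExponent Q Finset.univ j (r₀ + Finsupp.single i 1) = r₀ + Finsupp.single i 1 := by
  rw [chartExponent_eq_iff]
  refine ⟨?_, fun i' _ => rfl⟩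
  rw [degIn_univ, map_add, Finsupp.degree_single, Finsupp.add_apply, Finsupp.single_eq_of_ne hij.symm]; omega

/-- **(c4) THE `j`-AXIS AFTER A `j`-STEP**: `coeff (r₀ + n e_j)` of the child is `Σ_{f ≤ n+1} t^f · coeff (r₀ + (n+1−f) e_j + f e_φ)`
of the parent — the child's `j`-axis reads the parent along the line `x_φ = t x_j`. [folklore] [cite: Hauser2010, §I (P⁺)] -/
theorem coeff_step_axis (hG : ∀ E ∈ G.support, r₀ ≤ E ∧ E ≠ r₀) (hjφ : j ≠ φ) (hr₀ : r₀ φ = 0) (hQ : Q + r₀ j = r₀.degree + 1) (n : ℕ) :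
    coeff (r₀ + Finsupp.single j n) (chartTransform Q Finset.univ j (Hauser2010.shear j (Pi.single φ t) G)) =
      ∑ f ∈ Finset.range (n + 2), t ^ f * coeff (r₀ + Finsupp.single j (n + 1 - f) + Finsupp.single φ f) G := by
  rw [← chartExponent_base_add_single hQ n,
    coeff_chartTransform_chartExponent_of_le (le_degree_shear hG hjφ hr₀ hQ)
      (by rw [map_add, Finsupp.degree_single]; omega),
    coeff_shear_single hjφ]
  have hej : (r₀ + Finsupp.single j (n + 1)) j = r₀ j + (n + 1) := by
    rw [Finsupp.add_apply, Finsupp.single_eq_same]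
  have heφ : (r₀ + Finsupp.single j (n + 1)) φ = 0 := by
    rw [Finsupp.add_apply, Finsupp.single_eq_of_ne hjφ.symm, hr₀, add_zero]
  rw [hej, heφ, show r₀ j + (n + 1) + 1 = (n + 2) + r₀ j by ring, Finset.sum_range_add]
  -- the terms `f ≥ n + 2` dip below `r₀` in the letter `j`
  have htail : ∑ f ∈ Finset.range (r₀ j), ((0 + (n + 2 + f)).choose (n + 2 + f) : K) * t ^ (n + 2 + f) *
      coeff (((r₀ + Finsupp.single j (n + 1)).update j (r₀ j + (n + 1) - (n + 2 + f))).update φ (0 + (n + 2 + f))) G = 0 := by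
    refine Finset.sum_eq_zero fun f hf => ?_
    have hf' := Finset.mem_range.mp hf
    rw [coeff_eq_zero_of_lt_base hG (i := j), mul_zero]
    rw [Finsupp.coe_update, Function.update_of_ne hjφ, Finsupp.coe_update, Function.update_self]
    omega
  rw [htail, add_zero]
  refine Finset.sum_congr rfl fun f hf => ?_
  have hf' := Finset.mem_range.mp hf
  rw [zero_add, Nat.choose_self, Nat.cast_one, one_mul]
  congr 2
  ext i
  simp only [Finsupp.coe_update, Function.update_apply, Finsupp.add_apply, Finsupp.single_apply]
  by_cases hiφ : i = φ
  · subst hiφ; simp [hr₀, hjφ]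
  · by_cases hij : i = j
    · subst hij; simp [hiφ, Ne.symm hiφ]; omega
    · simp [hiφ, hij, Ne.symm hiφ, Ne.symm hij]

/-- **(c2) OFF-CHART DEGREE-ONE COEFFICIENTS ARE KEPT**: `coeff (r₀ + e_i)` of the child equals that of the parent for `i ≠ j`
(this includes `i = φ`: `λ_φ` is invariant). [folklore] [cite: Hauser2010, §I (P⁺)] -/
theorem coeff_step_single_of_ne (hG : ∀ E ∈ G.support, r₀ ≤ E ∧ E ≠ r₀) (hjφ : j ≠ φ) (hr₀ : r₀ φ = 0) (hQ : Q + r₀ j = r₀.degree + 1)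
    {i : Fin 4} (hij : i ≠ j) :
    coeff (r₀ + Finsupp.single i 1) (chartTransform Q Finset.univ j (Hauser2010.shear j (Pi.single φ t) G)) =
      coeff (r₀ + Finsupp.single i 1) G := by
  rw [← chartExponent_base_add_single_of_ne hQ hij,
    coeff_chartTransform_chartExponent_of_le (le_degree_shear hG hjφ hr₀ hQ)
      (by rw [map_add, Finsupp.degree_single]; omega),
    chartExponent_base_add_single_of_ne hQ hij, coeff_shear_single hjφ]
  have hej : (r₀ + Finsupp.single i 1 : Fin 4 →₀ ℕ) j = r₀ j := by
    rw [Finsupp.add_apply, Finsupp.single_eq_of_ne hij.symm, add_zero]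
  rw [hej, Finset.sum_range_succ']
  have htail : ∑ l ∈ Finset.range (r₀ j), (((r₀ + Finsupp.single i 1 : Fin 4 →₀ ℕ) φ + (l + 1)).choose (l + 1) : K) * t ^ (l + 1) *
      coeff (((r₀ + Finsupp.single i 1 : Fin 4 →₀ ℕ).update j (r₀ j - (l + 1))).update φ ((r₀ + Finsupp.single i 1 : Fin 4 →₀ ℕ) φ + (l + 1))) G = 0 := by
    refine Finset.sum_eq_zero fun l hl => ?_
    have hl' := Finset.mem_range.mp hl
    rw [coeff_eq_zero_of_lt_base hG (i := j), mul_zero]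
    rw [Finsupp.coe_update, Function.update_of_ne hjφ, Finsupp.coe_update, Function.update_self]
    omega
  rw [htail, zero_add, add_zero, Nat.choose_zero_right, Nat.cast_one, pow_zero, one_mul, one_mul, Nat.sub_zero, ← hej,
    Finsupp.update_self, Finsupp.update_self]

/-- **(c0) INCIDENCE READING**: the base coefficient of the child is `λ_j + t·λ_φ` (`λ_i := coeff (r₀ + e_i)` of the parent).
[folklore] [cite: Hauser2010, §I (P⁺)] -/
theorem coeff_step_base (hG : ∀ E ∈ G.support, r₀ ≤ E ∧ E ≠ r₀) (hjφ : j ≠ φ) (hr₀ : r₀ φ = 0) (hQ : Q + r₀ j = r₀.degree + 1) :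
    coeff r₀ (chartTransform Q Finset.univ j (Hauser2010.shear j (Pi.single φ t) G)) =
      coeff (r₀ + Finsupp.single j 1) G + t * coeff (r₀ + Finsupp.single φ 1) G := by
  have h := coeff_step_axis (t := t) hG hjφ hr₀ hQ 0
  rw [Finsupp.single_zero, add_zero] at h
  rw [h, Finset.sum_range_succ, Finset.sum_range_succ, Finset.sum_range_zero, zero_add, pow_zero, one_mul, pow_one,
    zero_add, Nat.sub_zero, Finsupp.single_zero, add_zero, Nat.sub_self, Finsupp.single_zero, add_zero]

/-- **(c3) AFTER A `j`-STEP THE `(i, φ)`-PLANE IS LINEAR** (`i ∉ {j, φ}`): every coefficient `r₀ + n e_i + l e_φ` with `n + l ≥ 2` of the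
child vanishes (degree-`≥ 2` monomials acquire the factor `x_j`). [folklore] [cite: Hauser2010, §I (P⁺)] -/
theorem coeff_step_plane_eq_zero (hG : ∀ E ∈ G.support, r₀ ≤ E ∧ E ≠ r₀) (hjφ : j ≠ φ) (hr₀ : r₀ φ = 0) (hQ : Q + r₀ j = r₀.degree + 1)
    {i : Fin 4} (hij : i ≠ j) {n l : ℕ} (hnl : 2 ≤ n + l) :
    coeff (r₀ + Finsupp.single i n + Finsupp.single φ l) (chartTransform Q Finset.univ j (Hauser2010.shear j (Pi.single φ t) G)) = 0 := by
  refine coeff_chartTransform_eq_zero_of_forall fun d hd hde => ?_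
  obtain ⟨hle, hne⟩ := above_shear hG hjφ hr₀ t d hd
  have hdeg := degree_lt_of_le_of_ne hle hne
  rw [chartExponent_eq_iff, degIn_univ] at hde
  obtain ⟨hj, hrest⟩ := hde
  rw [Finsupp.add_apply, Finsupp.add_apply, Finsupp.single_eq_of_ne hij.symm, Finsupp.single_eq_of_ne hjφ] at hj
  -- `|d| = d_j + Σ_{i' ≠ j} (target)_{i'}`; compute the degree of `d` letterwise
  have hsum : d.degree + r₀ j = d j + r₀.degree + n + l := by
    set T : Fin 4 →₀ ℕ := r₀ + Finsupp.single i n + Finsupp.single φ l with hT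
    have hTj : T j = r₀ j := by
      rw [hT, Finsupp.add_apply, Finsupp.add_apply, Finsupp.single_eq_of_ne hij.symm, Finsupp.single_eq_of_ne hjφ, add_zero,
        add_zero]
    have hTdeg : T.degree = r₀.degree + n + l := by
      rw [hT, map_add, map_add, Finsupp.degree_single, Finsupp.degree_single]
    have hd : d.degree = d j + ∑ i' ∈ Finset.univ.erase j, d i' := by
      rw [Finsupp.degree_eq_sum, ← Finset.add_sum_erase Finset.univ _ (Finset.mem_univ j)]
    have hTsum : T.degree = T j + ∑ i' ∈ Finset.univ.erase j, T i' := by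
      rw [Finsupp.degree_eq_sum, ← Finset.add_sum_erase Finset.univ _ (Finset.mem_univ j)]
    have hrest' : ∑ i' ∈ Finset.univ.erase j, d i' = ∑ i' ∈ Finset.univ.erase j, T i' :=
      Finset.sum_congr rfl fun i' hi' => (hrest i' (Finset.ne_of_mem_erase hi')).symm
    omega
  have := hle j
  omega

end Step

/-! ## 4. The weight-one chain: invariance of `λ_φ`, incidence, axis acquisition and persistence, finiteness -/

section Chain

variable {A B φ : Fin 4} {r₀ : Fin 4 →₀ ℕ} {Q : ℕ} {w : ℕ → MvPolynomial (Fin 4) K} {j : ℕ → Fin 4} {β : ℕ → K} {m : ℕ}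
  (hAφ : A ≠ φ) (hBφ : B ≠ φ) (hr₀φ : r₀ φ = 0) (hr₀AB : r₀ A = r₀ B) (hQ : Q + r₀ A = r₀.degree + 1)
  (hj : ∀ k, m ≤ k → j k = A ∨ j k = B)
  (hlaw : ∀ k, m ≤ k →
    w (k + 1) = chartTransform Q Finset.univ (j k) (Hauser2010.shear (j k) (Pi.single φ (β k)) (w k)))
  (habove : ∀ k, m ≤ k → ∀ E ∈ (w k).support, r₀ ≤ E ∧ E ≠ r₀)

include hAφ hBφ hj in
/-- the chart letter is never the free letter. -/
theorem chart_ne_free {k : ℕ} (hk : m ≤ k) : j k ≠ φ := by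
  rcases hj k hk with h | h <;> rw [h]
  · exact hAφ
  · exact hBφ

include hr₀AB hQ hj in
/-- the weight-one relation at every chart letter. -/
theorem hQ_chart {k : ℕ} (hk : m ≤ k) : Q + r₀ (j k) = r₀.degree + 1 := by
  rcases hj k hk with h | h <;> rw [h]
  · exact hQ
  · rw [← hr₀AB]; exact hQ

include hAφ hBφ hr₀φ hr₀AB hQ hj hlaw habove in
/-- **`λ_φ` IS INVARIANT**: `coeff (r₀ + e_φ) (w k) = coeff (r₀ + e_φ) (w m)` for all `k ≥ m`. [OURS] -/
theorem coeff_free_eq {k : ℕ} (hk : m ≤ k) :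
    coeff (r₀ + Finsupp.single φ 1) (w k) = coeff (r₀ + Finsupp.single φ 1) (w m) := by
  induction k, hk using Nat.le_induction with
  | base => rfl
  | succ k hk ih =>
    rw [hlaw k hk, coeff_step_single_of_ne (habove k hk) (chart_ne_free hAφ hBφ hj hk) hr₀φ (hQ_chart hr₀AB hQ hj hk)
      (chart_ne_free hAφ hBφ hj hk).symm, ih]

include hAφ hBφ hr₀φ hr₀AB hQ hj hlaw habove in
/-- **INCIDENCE**: `λ_{j k} + β_k · λ_φ = 0` at every step (the child vanishes at the new origin). [OURS] -/
theorem incidence {k : ℕ} (hk : m ≤ k) :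
    coeff (r₀ + Finsupp.single (j k) 1) (w k) + β k * coeff (r₀ + Finsupp.single φ 1) (w k) = 0 := by
  rw [← coeff_step_base (habove k hk) (chart_ne_free hAφ hBφ hj hk) hr₀φ (hQ_chart hr₀AB hQ hj hk), ← hlaw k hk]
  exact coeff_base_eq_zero (habove (k + 1) (by omega))

include hAφ hBφ hr₀φ hr₀AB hQ hj hlaw habove in
/-- **AXIS PERSISTENCE**: if the `a`-axis lies on `W_k` (`coeff (r₀ + n e_a) (w k) = 0` for all `n`) and `λ_φ ≠ 0`, then an `a`-step has
`β_k = 0`, and the `a`-axis lies on `W_{k+1}` (for either chart). [OURS] -/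
theorem axis_persist {a : Fin 4} {k : ℕ} (hk : m ≤ k) (hφ : coeff (r₀ + Finsupp.single φ 1) (w k) ≠ 0)
    (hP : ∀ n, coeff (r₀ + Finsupp.single a n) (w k) = 0) :
    (j k = a → β k = 0) ∧ ∀ n, coeff (r₀ + Finsupp.single a n) (w (k + 1)) = 0 := by
  have hjφ := chart_ne_free hAφ hBφ hj hk
  have hQk := hQ_chart hr₀AB hQ hj hk
  have hβ : j k = a → β k = 0 := fun hja => by
    have h := incidence hAφ hBφ hr₀φ hr₀AB hQ hj hlaw habove hk
    rw [hja, hP 1, zero_add] at h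
    rcases mul_eq_zero.mp h with h | h
    · exact h
    · exact absurd h hφ
  refine ⟨hβ, fun n => ?_⟩
  rw [hlaw k hk]
  by_cases hja : j k = a
  · rw [hja, coeff_step_axis (habove k hk) (hja ▸ hjφ) hr₀φ (hja ▸ hQk), hβ hja]
    refine Finset.sum_eq_zero fun f hf => ?_
    rcases Nat.eq_zero_or_pos f with rfl | hf0
    · rw [pow_zero, one_mul, Nat.sub_zero, Finsupp.single_zero, add_zero, hP]
    · rw [zero_pow (Nat.pos_iff_ne_zero.mp hf0), zero_mul]
  · rcases Nat.lt_or_ge n 2 with hn | hn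
    · interval_cases n
      · rw [Finsupp.single_zero, add_zero, ← hlaw k hk]
        exact coeff_base_eq_zero (habove (k + 1) (by omega))
      · rw [coeff_step_single_of_ne (habove k hk) hjφ hr₀φ hQk (Ne.symm hja), hP]
    · have h := coeff_step_plane_eq_zero (t := β k) (habove k hk) hjφ hr₀φ hQk (Ne.symm hja) (n := n) (l := 0) (by omega)
      rwa [Finsupp.single_zero, add_zero] at h

include hAφ hBφ hr₀φ hr₀AB hQ hj hlaw habove in
/-- **AXIS ACQUISITION**: a step NOT charting `a` followed by an `a`-step puts the `a`-axis on `W` two steps later (after the first step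
the `(a, φ)`-plane of `w` is the linear form `λ_a x_a + λ_φ x_φ`, which vanishes on the line `x_φ = β x_a` charted next). [OURS] -/
theorem axis_acquire {a : Fin 4} {k : ℕ} (hk : m ≤ k) (hk0 : j k ≠ a) (hk1 : j (k + 1) = a) :
    ∀ n, coeff (r₀ + Finsupp.single a n) (w (k + 2)) = 0 := by
  intro n
  rcases Nat.eq_zero_or_pos n with rfl | hn
  · rw [Finsupp.single_zero, add_zero]
    exact coeff_base_eq_zero (habove (k + 2) (by omega))
  have hjφ1 := chart_ne_free hAφ hBφ hj (show m ≤ k + 1 by omega)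
  have hQ1 := hQ_chart hr₀AB hQ hj (show m ≤ k + 1 by omega)
  rw [hk1] at hjφ1 hQ1
  rw [show k + 2 = k + 1 + 1 by ring, hlaw (k + 1) (by omega), hk1, coeff_step_axis (habove (k + 1) (by omega)) hjφ1 hr₀φ hQ1]
  refine Finset.sum_eq_zero fun f hf => ?_
  have hf' := Finset.mem_range.mp hf
  rw [hlaw k hk, coeff_step_plane_eq_zero (habove k hk) (chart_ne_free hAφ hBφ hj hk) hr₀φ (hQ_chart hr₀AB hQ hj hk)
    (Ne.symm hk0) (by omega), mul_zero]

/-- both letters charted beyond every time give a `(¬a, a)` transition beyond every time. -/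
theorem exists_transition {a : Fin 4} (ha : ∀ N, ∃ k, N ≤ k ∧ j k = a) (hna : ∀ N, ∃ k, N ≤ k ∧ j k ≠ a) (N : ℕ) :
    ∃ k, N ≤ k ∧ j k ≠ a ∧ j (k + 1) = a := by
  classical
  obtain ⟨k₀, hk₀, hk₀a⟩ := hna N
  have hex : ∃ o, j (k₀ + o) = a := by
    obtain ⟨k, hk, hka⟩ := ha k₀
    exact ⟨k - k₀, by rwa [Nat.add_sub_cancel' hk]⟩
  set o := Nat.find hex with ho
  have hoa : j (k₀ + o) = a := Nat.find_spec hex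
  have ho0 : o ≠ 0 := fun h => hk₀a (by rw [← hoa, h, add_zero])
  refine ⟨k₀ + (o - 1), by omega, fun h => ?_, by rw [show k₀ + (o - 1) + 1 = k₀ + o by omega]; exact hoa⟩
  exact Nat.find_min hex (show o - 1 < o by omega) h

include hAφ hBφ hr₀φ hr₀AB hQ hj hlaw habove in
/-- **THE TRANSLATIONS OF A WEIGHT-ONE CHAIN DIE**: with `λ_φ ≠ 0` at time `m` and both letters charted beyond every time, `β_k = 0` for all
large `k`. [OURS · memo L-LIGHT-KILL-g6 §5] [cite: CossartJannsenSaito2020, Lemma 13.2] [cite: Hauser2010, §I] -/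
theorem weightOne_translations_eventually_zero (hAB : A ≠ B) (hφ : coeff (r₀ + Finsupp.single φ 1) (w m) ≠ 0)
    (hA : ∀ N, ∃ k, N ≤ k ∧ j k = A) (hB : ∀ N, ∃ k, N ≤ k ∧ j k = B) :
    ∃ T, ∀ k, T ≤ k → β k = 0 := by
  -- `λ_φ ≠ 0` for ever
  have hφk : ∀ k, m ≤ k → coeff (r₀ + Finsupp.single φ 1) (w k) ≠ 0 := fun k hk => by
    rw [coeff_free_eq hAφ hBφ hr₀φ hr₀AB hQ hj hlaw habove hk]; exact hφ
  -- not-`a` times beyond every time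
  have hnA : ∀ N, ∃ k, N ≤ k ∧ j k ≠ A := fun N => by
    obtain ⟨k, hk, hkB⟩ := hB N; exact ⟨k, hk, by rw [hkB]; exact hAB.symm⟩
  have hnB : ∀ N, ∃ k, N ≤ k ∧ j k ≠ B := fun N => by
    obtain ⟨k, hk, hkA⟩ := hA N; exact ⟨k, hk, by rw [hkA]; exact hAB⟩
  -- persistence packaged
  have hpers : ∀ a, ∀ k₀, m ≤ k₀ → (∀ n, coeff (r₀ + Finsupp.single a n) (w k₀) = 0) →
      ∀ k, k₀ ≤ k → (∀ n, coeff (r₀ + Finsupp.single a n) (w k) = 0) ∧ (j k = a → β k = 0) := by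
    intro a k₀ hk₀ hP k hk
    induction k, hk using Nat.le_induction with
    | base => exact ⟨hP, (axis_persist hAφ hBφ hr₀φ hr₀AB hQ hj hlaw habove hk₀ (hφk k₀ hk₀) hP).1⟩
    | succ k hk ih =>
      have h := axis_persist hAφ hBφ hr₀φ hr₀AB hQ hj hlaw habove (by omega) (hφk k (by omega)) ih.1
      exact ⟨h.2, (axis_persist hAφ hBφ hr₀φ hr₀AB hQ hj hlaw habove (by omega) (hφk (k + 1) (by omega)) h.2).1⟩
  -- the `A`-axis, then the `B`-axis
  obtain ⟨k₁, hk₁, hk₁A, hk₁A'⟩ := exists_transition hA hnA m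
  have hPA := axis_acquire hAφ hBφ hr₀φ hr₀AB hQ hj hlaw habove hk₁ hk₁A hk₁A'
  obtain ⟨k₂, hk₂, hk₂B, hk₂B'⟩ := exists_transition hB hnB (k₁ + 2)
  have hPB := axis_acquire hAφ hBφ hr₀φ hr₀AB hQ hj hlaw habove (show m ≤ k₂ by omega) hk₂B hk₂B'
  refine ⟨k₂ + 2, fun k hk => ?_⟩
  rcases hj k (by omega) with hkA | hkB
  · exact (hpers A (k₁ + 2) (by omega) hPA k (by omega)).2 hkA
  · exact (hpers B (k₂ + 2) (by omega) hPB k (by omega)).2 hkB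

end Chain

end LLight

end ResCone

end Summit.ResolutionOfSingularities.ResolutionOfSingularities.Theorems.PIDim4

end
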